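import Summits.HubbardSuperconductivity.HubbardSuperconductivity.Theorems.AnisotropyChordTransferFibre3FinX3GM3TwentyFive
import Summits.HubbardSuperconductivity.HubbardSuperconductivity.Theorems.AnisotropyChordTransferFibre3FinX5GM3TwentySix
import Summits.HubbardSuperconductivity.HubbardSuperconductivity.Theorems.AnisotropyChordTransferFibre3FinX5GM3TwentySeven
import Summits.HubbardSuperconductivity.HubbardSuperconductivity.Theorems.AnisotropyChordTransferFibre3FinX5GM3TwentyEight
import Summits.HubbardSuperconductivity.HubbardSuperconductivity.Theorems.AnisotropyChordTransferFibre3FinX5GM3TwentyNine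
import Summits.HubbardSuperconductivity.HubbardSuperconductivity.Theorems.AnisotropyChordTransferFibre3FinX5GM3Thirty
import Summits.HubbardSuperconductivity.HubbardSuperconductivity.Theorems.AnisotropyChordTransferFibre3FinX5GM3ThirtyOne
import Summits.HubbardSuperconductivity.HubbardSuperconductivity.Theorems.AnisotropyChordTransferFibre3FinX5GM3ThirtyTwo

/-!
# Route `AnisotropyChord` / H0 rotor rung: ★★★★ GM₃ FOR EVERY `25 ≤ L ≤ 32` AND EVERY `0 < Δ ≤ 0.98`

`gm3_range_25_32`: the per-`L` kernel-certified GM₃ theorems `gm3_<word>` (`…FinX3GM3<Word>` / `…FinX5GM3<Word>`, X4/X5 per-`L` certificates of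
prover seat `hubbard-h0-rotor-p3` g8) assembled by `interval_cases`; continues g7's `gm3_range` (`9 ≤ L ≤ 24`, `…FinXDGM3Range`).
Helper for piece A = stmt-HubbardSuperconductivity-23918 of rung 19089 (`--supports`, helper class).  WHAT THIS IS NOT: nothing here proves
superconductivity in the Hubbard model (rotor TARGET as worded stays FALSE, g15 verdict); the finite-`L` GM₃ input of ONE conditional reduction.
-/

set_option linter.dupNamespace false
set_option autoImplicit false

namespace Summit.HubbardSuperconductivity.HubbardSuperconductivity.Theorems.AnisotropyChord.Transfer.Fibre3

/-- ★★★★ **GM₃ for every `25 ≤ L ≤ 32`, `0 < Δ ≤ 0.98`**, kernel-certified per `L` from zero data. [folklore] -/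
theorem gm3_range_25_32 (L : ℕ) [NeZero L] (hlo : 25 ≤ L) (hhi : L ≤ 32) {Δ : ℝ} (hΔ0 : 0 < Δ) (hΔ1 : Δ ≤ 0.98) :
    GM3Fibre L Δ := by
  interval_cases L
  · exact gm3_twentyfive hΔ0 hΔ1
  · exact gm3_twentysix hΔ0 hΔ1
  · exact gm3_twentyseven hΔ0 hΔ1
  · exact gm3_twentyeight hΔ0 hΔ1
  · exact gm3_twentynine hΔ0 hΔ1
  · exact gm3_thirty hΔ0 hΔ1
  · exact gm3_thirtyone hΔ0 hΔ1
  · exact gm3_thirtytwo hΔ0 hΔ1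

end Summit.HubbardSuperconductivity.HubbardSuperconductivity.Theorems.AnisotropyChord.Transfer.Fibre3
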